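import Literature.NumberTheory.Automorphic.EichlerSelbergBrandtResummation
import Literature.NumberTheory.Automorphic.EichlerEmbeddingLocalRamified
import Literature.NumberTheory.Automorphic.BrandtMatrixRamified
import Literature.NumberTheory.Automorphic.BrandtModuleDictionary
import HarnessLib

/-!
# The elliptic terms of `tr B(n)` for a Brandt setup: `Σ_i #{x ∈ O_i : (trd, nrd) = (t, n)}/(2wᵢ)`

Topic `NumberTheory/Automorphic`; theorems only (no named fact, no `sorry`).  Fifteenth brick of
the Brandt-module side of the Eichler–Pizer trace identity: for a Brandt setup `S` of level
`(M, p)` (`M` squarefree, `p ∤ M` prime: `O` an Eichler order of level `M` in the definite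
quaternion algebra of discriminant `p`) and `γ ∈ D` with `trd γ = t`, `nrd γ = n`, `t² < 4n`,

`Σ_i #{x ∈ O_L(I_i) : trd x = t, nrd x = n} / (2 w_i) = ½ Σ_f h_w((t² - 4n)/f²) (∏_{q ∣ M} m_q(f)) m_p(f)`

(`XiSetup.sum_card_traceNormSet_div_eq_sum_hw_br`), the sum over the conductors `f` of `(t, n)`,
with the local embedding numbers `m_q(f) = ρ_q(t_f, n_f) + [fq conductor]` (`brFactor`, from
`LevelHyp.localEmbeddingNumber_eq`) and `m_p(f) = [fp not a conductor] (2 - ρ_p(t_f, n_f))`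
(`brFactorRam`, from `RamHyp.localEmbeddingNumber_eq`). Assembly of: the optimal-embedding
count (`XiSetup.sum_card_traceNormSet_div_eq_finsum`), the local–global count
(`card_throughClass_optimalOrder_eq`), the matrix models of `O` at `q ∤ Mp` and `q ∣ M`
(`XiSetup.exists_localAt_iff_integral`, `XiSetup.exists_levelModel`), the orders through `γ`
(`GammaHyp.exists_eq_ordOf`), `h(B_f) = h(disc B_f)` and `#B_fˣ = w(disc B_f)`.

## References

* M.-F. Vignéras, *Arithmétique des algèbres de quaternions*, LNM 800 (1980), Ch. III §5
  Thm. 5.11, Cor. 5.12, Exercice 5.2; Ch. V §2 Prop. 2.4, [VignerasLNM800].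
* M. Eichler, *Zur Zahlentheorie der Quaternionen-Algebren*, J. reine angew. Math. 195 (1955),
  [Eichler1955].
-/

noncomputable section

open scoped Pointwise Matrix
open Finset

universe u

namespace Literature.NumberTheory.Automorphic

open HeckeTraceFormulaGL2Level NumberField IsDedekindDomain

namespace Brandt

variable {M p : ℕ}

/-! ### The matrix model at a prime `q ∥ M` -/

/-- **At a prime `q ∣ M`, `M` squarefree, `q ≠ p`, the Eichler order of a Brandt setup of level
`(M, p)` has a level-`q` matrix model** `O_(q) = Φ⁻¹(ℤ_q ℤ_q; qℤ_q ℤ_q)`. [cite: VignerasLNM800, Ch. III §5 Prop. 5.1 (propriétés locales (3)), Ch. II §2 Lemme 2.4] -/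
theorem XiSetup.exists_levelModel (S : XiSetup M p) (hM : M ≠ 0) (hsq : Squarefree M) {q : ℕ}
    [hq : Fact q.Prime] (hqM : q ∣ M) (hqp : ¬ q ∣ p) :
    ∃ Φ : S.D →ₐ[ℚ] Matrix (Fin 2) (Fin 2) ℚ_[q],
      ∀ y : S.D, y ∈ localAt q S.O ↔ (∀ i j, ‖Φ y i j‖ ≤ 1) ∧ ‖Φ y 1 0‖ ≤ (q : ℝ)⁻¹ := by
  have hD : ∀ x : S.D, x ≠ 0 → IsUnit x := fun _ hx => isUnit_of_isTotallyDefinite S.D S.isTotallyDefinite hx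
  have hram : ∀ v : HeightOneSpectrum (𝓞 ℚ),
      v ∈ ramifiedPlaces ℚ S.D ↔ ((p : ℕ) : 𝓞 ℚ) ∈ v.asIdeal :=
    S.toEichlerPackage.mem_ramifiedPlaces_iff
  obtain ⟨φ⟩ := exists_algHom_matrix_of_not_dvd (B := S.D) hram hqp
  obtain ⟨u, hu⟩ := S.toEichlerPackage.isEichlerOrder.exists_conjUnit_localAt_iff_eichler hD hM φ
  refine ⟨AlgHom.conjUnit φ u, fun y => ?_⟩
  have h1 : M.factorization q = 1 :=
    le_antisymm (hsq.natFactorization_le_one q) ((hq.out.dvd_iff_one_le_factorization hM).mp hqM)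
  have hu' : y ∈ localAt q S.O ↔ (∀ i j, ‖AlgHom.conjUnit φ u y i j‖ ≤ 1) ∧
      ‖AlgHom.conjUnit φ u y 1 0‖ ≤ (q : ℝ) ^ (-(M.factorization q : ℤ)) := hu y
  rw [hu', h1]
  simp

/-! ### The elliptic terms -/

section Elliptic

variable (S : XiSetup M p) {γ : S.D} {t : ℤ} {n : ℕ}

/-- `D` is a division algebra. [folklore] -/
theorem XiSetup.hdiv : ∀ x : S.D, x ≠ 0 → IsUnit x := fun _ hx =>
  isUnit_of_isTotallyDefinite S.D S.isTotallyDefinite hx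

/-- **The local embedding number at `q ∣ M` is `m_q(f) = ρ_q(t_f, n_f) + [fq conductor]`.** [cite: VignerasLNM800, Ch. II §3; Ch. III §5 Exercice 5.2] -/
theorem XiSetup.localEmbeddingNumber_ordOf_level (hM : M ≠ 0) (hsq : Squarefree M) (H : GammaHyp γ t n)
    {q : ℕ} (hq : q.Prime) (hqM : q ∣ M) (hqp : ¬ q ∣ p) {f : ℕ} (hf : f ∈ ellipticConductors t n) :
    (localEmbeddingNumber S.O γ (ordOf γ t n f) q : ℚ) = brFactor q t n f := by
  classical
  haveI := Fact.mk hq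
  obtain ⟨Φ, hΦ⟩ := S.exists_levelModel hM hsq hqM hqp
  have hO := S.isEichlerOrder.isOrder
  have HL : LevelHyp Φ S.O γ (ordOf γ t n f) (σf γ t n f) ((shift t n : ℚ) / f) f (tOf t n f) (nOf t n f) :=
    { hD := S.hdiv
      hγ := H.hγ
      hO := hΦ
      hO1 := hO.one_mem
      hOmul := hO.mul_mem
      hB := H.isQuadOrder_ordOf hf
      hm := (pos_of_mem_ellipticConductors H.hlt hf).ne'
      hσ₀ := rfl
      hBσ := fun _ => mem_ordOf_iff
      hsq := H.σf_sq hf }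
  rw [HL.localEmbeddingNumber_eq, card_filter_add_eq_rho hq.ne_zero, brFactor]
  push_cast
  simp [nonmax_iff H.hlt hq hf]

/-- **The local embedding number at the ramified prime is
`m_p(f) = [fp not a conductor] (2 - ρ_p(t_f, n_f))`.** [cite: VignerasLNM800, Ch. II §3; Ch. III §5 Exercice 5.2] -/
theorem XiSetup.localEmbeddingNumber_ordOf_ram (hp : p.Prime) (H : GammaHyp γ t n)
    {f : ℕ} (hf : f ∈ ellipticConductors t n) :
    (localEmbeddingNumber S.O γ (ordOf γ t n f) p : ℚ) = brFactorRam p t n f := by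
  classical
  haveI := Fact.mk hp
  have HR : RamHyp p S.O γ (ordOf γ t n f) (σf γ t n f) ((shift t n : ℚ) / f) f (tOf t n f) (nOf t n f) :=
    { hdivp := S.toEichlerPackage.forall_isUnit_scalarExtension_padic (dvd_refl p)
      hOZ := S.toEichlerPackage.isEichlerOrder.isZOrder
      hOp := S.toEichlerPackage.maximalAtP (dvd_refl p)
      hγ := H.hγ
      hB := H.isQuadOrder_ordOf hf
      hm := (pos_of_mem_ellipticConductors H.hlt hf).ne'
      hσ₀ := rfl
      hBσ := fun _ => mem_ordOf_iff
      hsq := H.σf_sq hf }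
  rw [HR.localEmbeddingNumber_eq, card_filter_add_eq_rho hp.ne_zero, brFactorRam]
  simp only [nonmax_iff H.hlt hp hf]
  split_ifs
  · simp
  · have := rho_le_two hp (tOf t n f) (nOf t n f)
    push_cast [this]
    rfl

/-- **The number of classes of ideals through `γ` with optimal order `B_f`, divided by `#B_fˣ`**:
`= ½ h_w(disc B_f) (∏_{q ∣ M} m_q(f)) m_p(f)`. [cite: VignerasLNM800, Ch. III §5 Thm. 5.11 and Cor. 5.12] -/
theorem XiSetup.card_throughClass_ordOf_div (hM : M ≠ 0) (hsq : Squarefree M) (hp : p.Prime) (hpM : ¬ p ∣ M)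
    (H : GammaHyp γ t n) {f : ℕ} (hf : f ∈ ellipticConductors t n) :
    (Nat.card {c : ThroughClass S.O γ // optimalOrder c.rep γ = ordOf γ t n f} : ℚ) /
        Nat.card {x : S.D // x ∈ ordOf γ t n f ∧ ∃ y ∈ ordOf γ t n f, x * y = 1 ∧ y * x = 1} =
      (1 / 2 : ℚ) * (hw t n f * ((∏ q ∈ M.primeFactors, brFactor q t n f) * brFactorRam p t n f)) := by
  classical
  have hO := S.isEichlerOrder.isOrder
  have hB := H.isQuadOrder_ordOf hf
  obtain ⟨S₁, hS₁, hS₁'⟩ := exists_finset_optimalOrder_localAt_eq hO hB (O := S.O)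
  set S₀ : Finset ℕ := (M * p).primeFactors ∪ S₁ with hS₀
  have hS₀p : ∀ q ∈ S₀, q.Prime := by
    intro q hq
    rcases Finset.mem_union.mp hq with h | h
    · exact Nat.prime_of_mem_primeFactors h
    · exact hS₁ q h
  have h0 : ∀ q : ℕ, q.Prime → q ∉ S₀ → optimalOrder (localAt q S.O) γ = localAt q (ordOf γ t n f) :=
    fun q hq hqS => hS₁' q hq fun h => hqS (Finset.mem_union_right _ h)
  have hMp0 : M * p ≠ 0 := mul_ne_zero hM hp.ne_zero
  have hndvd : ∀ q : ℕ, q.Prime → q ∉ S₀ → ¬ q ∣ M * p := fun q hq hqS hd =>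
    hqS (Finset.mem_union_left _ (Nat.mem_primeFactors.mpr ⟨hq, hd, hMp0⟩))
  have h1 : ∀ q : ℕ, q.Prime → q ∉ S₀ → ∀ L ∈ localIdeals S.O γ (ordOf γ t n f) q,
      ∃ c : S.Dˣ, (c : S.D) * γ = γ * c ∧ L = c • localAt q S.O := by
    intro q hq hqS L hL
    haveI := Fact.mk hq
    obtain ⟨Φ, hΦ⟩ := S.exists_localAt_iff_integral hM (hndvd q hq hqS)
    exact exists_eq_smul_localAt_of_model Φ S.hdiv H.hγ hΦ hO.one_mem hO.mul_mem (h0 q hq hqS) hL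
  rw [card_throughClass_optimalOrder_eq S.isTotallyDefinite hO H.hγ hB S₀ hS₀p h0 h1]
  -- the product over `S₀`
  have hsplit : S₀ = (M * p).primeFactors ∪ (S₁ \ (M * p).primeFactors) := by
    rw [hS₀, Finset.union_sdiff_self_eq_union]
  have hone : ∀ q ∈ S₁ \ (M * p).primeFactors, localEmbeddingNumber S.O γ (ordOf γ t n f) q = 1 := by
    intro q hq
    rw [Finset.mem_sdiff] at hq
    have hqp : q.Prime := hS₁ q hq.1
    haveI := Fact.mk hqp
    have hnd : ¬ q ∣ M * p := fun hd => hq.2 (Nat.mem_primeFactors.mpr ⟨hqp, hd, hMp0⟩)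
    obtain ⟨Φ, hΦ⟩ := S.exists_localAt_iff_integral hM hnd
    exact localEmbeddingNumber_eq_one_of_model Φ S.hdiv H.hγ hΦ hO.one_mem hO.mul_mem hB
  have hprod : ∏ q ∈ S₀, localEmbeddingNumber S.O γ (ordOf γ t n f) q =
      (∏ q ∈ M.primeFactors, localEmbeddingNumber S.O γ (ordOf γ t n f) q) *
        localEmbeddingNumber S.O γ (ordOf γ t n f) p := by
    rw [hsplit, Finset.prod_union Finset.disjoint_sdiff, Finset.prod_eq_one hone, mul_one,
      Nat.primeFactors_mul hM hp.ne_zero, hp.primeFactors, Finset.prod_union, Finset.prod_singleton]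
    rw [Finset.disjoint_singleton_right]
    exact fun h => hpM (Nat.dvd_of_mem_primeFactors h)
  rw [hprod, H.classNumber_ordOf hf, (H.picHyp_ordOf hf).card_units_eq]
  have hpf : ∀ q ∈ M.primeFactors, (localEmbeddingNumber S.O γ (ordOf γ t n f) q : ℚ) = brFactor q t n f := by
    intro q hq
    have hqp := Nat.prime_of_mem_primeFactors hq
    refine S.localEmbeddingNumber_ordOf_level hM hsq H hqp (Nat.dvd_of_mem_primeFactors hq) ?_ hf
    intro hd
    exact hpM (((Nat.prime_dvd_prime_iff_eq hqp hp).mp hd) ▸ Nat.dvd_of_mem_primeFactors hq)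
  push_cast
  rw [Finset.prod_congr rfl hpf, S.localEmbeddingNumber_ordOf_ram hp H hf, hw, disc_div_sq H.hlt hf,
    weightedClassNumber_eq]
  have hw0 : ((if tOf t n f ^ 2 - 4 * nOf t n f = -3 then 6 else if tOf t n f ^ 2 - 4 * nOf t n f = -4 then 4 else 2 : ℕ) : ℚ) ≠ 0 := by
    split_ifs <;> norm_num
  unfold unitsOfDisc
  field_simp
  push_cast
  ring

/-- **The elliptic terms of the trace of the Brandt matrix, evaluated**: for a Brandt setup of
level `(M, p)` (`M` squarefree, `p ∤ M`) and `γ` with `trd γ = t`, `nrd γ = n`, `t² < 4n`,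
`Σ_i #{x ∈ O_L(I_i) : trd x = t, nrd x = n}/(2wᵢ) = ½ Σ_f h_w((t² - 4n)/f²) (∏_{q ∣ M} m_q(f)) m_p(f)`. [cite: VignerasLNM800, Ch. V §2 Prop. 2.4; Ch. III §5 Thm. 5.11, Cor. 5.12, Exercice 5.2] -/
theorem XiSetup.sum_card_traceNormSet_div_eq_sum_hw_br [Fintype (ClassSet S.O)] (hM : M ≠ 0)
    (hsq : Squarefree M) (hp : p.Prime) (hpM : ¬ p ∣ M) (H : GammaHyp γ t n) :
    ∑ i, (Nat.card (traceNormSet i.rep (t : ℚ) (n : ℚ)) : ℚ) / (2 * weight S.O i) =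
      (1 / 2 : ℚ) * ∑ f ∈ ellipticConductors t n,
        hw t n f * ((∏ q ∈ M.primeFactors, brFactor q t n f) * brFactorRam p t n f) := by
  classical
  haveI : IsAddTorsionFree S.D := isAddTorsionFree_of_charZero_module ℚ S.D
  rw [show ((t : ℚ)) = reducedTrace ℚ S.D γ from H.htr.symm,
    show ((n : ℚ)) = reducedNorm ℚ S.D γ from H.hnr.symm, S.sum_card_traceNormSet_div_eq_finsum H.hγ]
  -- the support of the summand consists of orders `B_f`
  set G : Submodule ℤ S.D → ℚ := fun B =>
    (Nat.card {c : ThroughClass S.O γ // optimalOrder c.rep γ = B} : ℚ) /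
      Nat.card {x : S.D // x ∈ B ∧ ∃ y ∈ B, x * y = 1 ∧ y * x = 1} with hG
  have hsupp : Function.support G ⊆ ((ellipticConductors t n).image (ordOf γ t n) : Finset (Submodule ℤ S.D)) := by
    intro B hB
    rw [Function.mem_support] at hB
    have hN : Nat.card {c : ThroughClass S.O γ // optimalOrder c.rep γ = B} ≠ 0 := by
      intro h0; apply hB; simp only [hG, h0, Nat.cast_zero, zero_div]
    have hne : Nonempty {c : ThroughClass S.O γ // optimalOrder c.rep γ = B} := by
      by_contra hne
      rw [not_nonempty_iff] at hne
      exact hN Nat.card_of_isEmpty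
    obtain ⟨⟨c, hc⟩⟩ := hne
    have hBq : IsQuadOrder γ B := by
      rw [← hc]
      exact isQuadOrder_optimalOrder c.rep_mem.1.1 c.rep_mem.2
    obtain ⟨f, hf, rfl⟩ := H.exists_eq_ordOf hBq
    exact Finset.mem_coe.mpr (Finset.mem_image_of_mem _ hf)
  rw [finsum_eq_sum_of_support_subset G hsupp,
    Finset.sum_image fun f hf g hg hfg => H.ordOf_injective hf hg hfg, Finset.mul_sum]
  refine Finset.sum_congr rfl fun f hf => ?_
  exact S.card_throughClass_ordOf_div hM hsq hp hpM H hf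

end Elliptic

end Brandt

end Literature.NumberTheory.Automorphic

end
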